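import Summits.FinalStateConjecture.FinalStateConjecture.Theorems.PhotonSphereChannelsChannelsResolveTameDevelopmentsRTameEndgame
import Summits.FinalStateConjecture.FinalStateConjecture.Theorems.PhotonSphereChannelsChannelsResolveTameDevelopmentsRHorizonPathsExist
import Summits.FinalStateConjecture.FinalStateConjecture.Theorems.PhotonSphereChannelsDarkFutureDefs
import HarnessLib

/-!
# Crux `ChannelsResolveTameDevelopmentsR` (K2R-T2, stmt-FinalStateConjecture-17430), line `tame-lasalle-dock`,
# stub T′ `stub_tameEndgame` — the ENDGAME as a typed reduction: late chart data, the chart predicates (M2) hole charts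
# converge out to growing radii, (M3) the radiation chart decays, (M4) the charts exhaust the honest exterior, the
# finiteness input (M1) late horizon components, and the assembly of the K2R♭ conclusion

Stub T′ (skeleton `Cruxes/ChannelsResolveTameDevelopmentsR/Lines/tame-lasalle-dock.lean`, verbatim the T of line
`dark-future-exactness`) concludes `∃ O d, O = exteriorOf 𝒟 d.charted ∧ HasExhaustiveCharts d ∧ IsFutureOriented d`
from `DevHyp`, a nonempty outer region and a classified all-orders class `(Λ, r₀)` ((a) outer hull, (b) generator hull,
(c) every silent outer hull element Minkowski or a sub-extremal Kerr d.o.c., (d) one sub-extremal `(M, a)` per horizon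
generator path). The transfer "classified hull ⇒ late charts" is XL; this file types its residual inputs over the landed
vocabulary and proves T′ from them, kernel-checked:

* §1 `LateChartData 𝓢 N mass spin` — the RAW chart data of an `N`-hole decomposition (no clause), its `charted` region,
  certified sets and `honestRadius`; over a Cauchy development, with the HONEST region `exteriorOf 𝒟 C.charted`:
  (M2) `HoleChartsConverge` — late Kerr charts converging in `C²` out to GROWING radii `Rᵢ → ∞` (no floor), (M2ο)
  orthochronous motions and future-oriented Kerr–Schild time; (M3) `FlatChartDecays` — sublinear tubes, flat domain
  `⊇ {x⁰ > τ₀} ∖ tubes`, full `C²` decay, flat-time orientation ONLY WHEN `0 < N`; (M4) `ChartsExhaust` — separation of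
  the holes and causal exhaustion of the honest exterior by the certified slabs for every `τ₁ ≥ τ₀`.
* §2 `exists_decomposition_of_charts` — (M2) ∧ (M3) ∧ (M4) with sub-extremal parameters ⇒ T′'s conclusion, `d.N = N`:
  fixed-radius convergence from growing radii (eventually `R ≤ Rᵢ(τ)`, monotonicity), the honest floor
  `Rᵢ ≥ max(r₊,0)+1` by `honestRadius` (eventually equal radii, exhaustion monotone), the structure's covering clause =
  exhaustion at `τ₀` (`diff_charted_subset_causalPast`), honesty definitional, and at `N = 0` flat orientation is
  `DarkFuture.flatChart_eventually_isFutureDirected` (p150272); `exists_decomposition_dispersive` — ON THE DISPERSIVE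
  FIBRE the stub closes given exactly a flat late chart (half-space domain, honest late chart, `C²` decay, exhaustion).
* §3 (M1) `LateJoined`, `RepresentsLateComponents 𝒟 γ_`, `FiniteLateHorizonComponents 𝒟` — finitely many late
  components of `horizonOf 𝒟 ∖ J⁻(Kₙ)` along compacta `Kₙ` swallowing the horizon, with representative generator paths;
  holds with `N = 0` on the fibre `horizonOf 𝒟 = ∅`, and `N = 0 ↔ horizonOf 𝒟 = ∅` (`…RHorizonPathsExist`).
* §4 `tameEndgame_of_assembly` — T′'s registered text VERBATIM as conclusion: (d) instantiated at the representatives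
  fixes the hole parameters (`choose`), the chart producer (M2)–(M4) is called with them, §2 assembles.

NOT here (what T′ still owes, `work/stubs/stub_tameEndgame.md`): the producers of (M1) (curvature quantum + mass/area
budget), (M2) (gluing exactly-Kerr near-zone views along `γᵢ` into one late chart), (M3) (radiation chart from the
Minkowski classification (c) + uniform far constants), (M4) (horizon-normalised bookkeeping).

References: Dafermos–Luk arXiv:1710.01722, Conj. 1 [DafermosLuk2017]; DHRT arXiv:2104.08222, §1 [arXiv210408222];
Hawking–Ellis 1973, §9.2 [HawkingEllis1973CUP]; Christodoulou–Klainerman 1993, Thm. 1.0.2 [ChristodoulouKlainerman1993].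
-/

noncomputable section

-- the operator-norm instance on `E4 →L[ℝ] E4 →L[ℝ] ℝ` needs one more level of pending
-- instance problems than the default (as in `PhotonSphereChannelsKerrDevDefs.lean`)
set_option maxSynthPendingDepth 3
-- every `Summit.FinalStateConjecture.FinalStateConjecture.…` name repeats the summit = sub-problem segment (D-0017 layout)
set_option linter.dupNamespace false

open Set Filter Function TopologicalSpace Manifold Bundle
open scoped Topology Manifold ContDiff ENNReal NNReal

namespace Summit.FinalStateConjecture.FinalStateConjecture.Theorems.TameLaSalle

open Literature.Geometry.Lorentzian
open Summit.FinalStateConjecture.FinalStateConjecture.Theorems.TameHull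
open Summit.FinalStateConjecture.FinalStateConjecture.Theorems.DarkFuture

universe u

/-! ### §1 Late chart data and the three chart predicates (M2), (M3), (M4) -/

/-- **Raw late chart data of an `N`-hole decomposition** of a spacetime with prescribed masses and spins: motions
`(Λᵢ, cᵢ)`, a common late time `τ₀`, hole charts on the boosted Kerr exteriors, near-zone radii `Rᵢ(τ)`, excision
radii `ρᵢ(t)`, the flat domain and the flat chart — the data fields of `FinalStateDecomposition` plus the radii of
`HasExhaustiveCharts`, with NO clause (the clauses are (M2)–(M4)). [cite: arXiv210408222, §1] -/
structure LateChartData (𝓢 : Spacetime.{u} 4) (N : ℕ) (mass spin : Fin N → ℝ) where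
  /-- The asymptotic motion `(Λᵢ, cᵢ)` of hole `i`. -/
  motion : Fin N → lorentzGroup × E4
  /-- The common initial late time. -/
  τ₀ : ℝ
  /-- The late chart of hole `i` on the boosted Kerr exterior. -/
  chart : ∀ i, boostedKerrExterior (motion i).1 (motion i).2 (mass i) (spin i) → 𝓢.carrier
  /-- The near-zone radii `Rᵢ(τ)`. -/
  radius : Fin N → ℝ → ℝ
  /-- The excision radii `ρᵢ(t)` of the tubes in the flat chart. -/
  excision : Fin N → ℝ → ℝ
  /-- The coordinate domain of the flat chart. -/
  flatDomain : Opens E4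
  /-- The flat (radiation-zone) chart. -/
  flatChart : flatDomain → 𝓢.carrier

namespace LateChartData

variable {𝓢 : Spacetime.{u} 4} {N : ℕ} {mass spin : Fin N → ℝ}

/-- The boosted Kerr background of hole `i`. [folklore] -/
def background (C : LateChartData 𝓢 N mass spin) (i : Fin N) : ModelBackground :=
  boostedKerrBackground (C.motion i).1 (C.motion i).2 (mass i) (spin i)

/-- The charted late region: flat image of `{x⁰ > τ₀} ∩ U₀` and the hole images of `{t*ᵢ > τ₀}` (the body of
`FinalStateDecomposition.charted`). [cite: DafermosLuk2017, Conjecture 1] -/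
def charted (C : LateChartData 𝓢 N mass spin) : Set 𝓢.carrier :=
  C.flatChart '' (Minkowski.backgroundOn C.flatDomain).lateRegion C.τ₀ ∪
    ⋃ i, C.chart i '' (C.background i).lateRegion C.τ₀

/-- The certified late region after `τ₁` for radii `R` (the body of `Summit.FinalStateConjecture.certifiedLate`).
[cite: DafermosLuk2017, Conjecture 1 (b)] -/
def certifiedLate (C : LateChartData 𝓢 N mass spin) (R : Fin N → ℝ → ℝ) (τ₁ : ℝ) : Set 𝓢.carrier :=
  C.flatChart '' (Minkowski.backgroundOn C.flatDomain).lateRegion τ₁ ∪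
    ⋃ i, C.chart i '' {x | τ₁ < (C.background i).time x.1 ∧
      (C.background i).radius x.1 ≤ R i ((C.background i).time x.1)}

/-- The certified slab at `τ₁` for radii `R` (the body of `Summit.FinalStateConjecture.certifiedSlab`).
[cite: DafermosLuk2017, Conjecture 1 (b)] -/
def certifiedSlab (C : LateChartData 𝓢 N mass spin) (R : Fin N → ℝ → ℝ) (τ₁ : ℝ) : Set 𝓢.carrier :=
  C.flatChart '' (Minkowski.backgroundOn C.flatDomain).timeSlab τ₁ ∪
    ⋃ i, C.chart i '' (C.background i).truncTimeSlab (R i τ₁) τ₁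

/-- Certified late regions grow with the radii. [folklore] -/
theorem certifiedLate_mono (C : LateChartData 𝓢 N mass spin) {R R' : Fin N → ℝ → ℝ}
    (h : ∀ i τ, R i τ ≤ R' i τ) (τ₁ : ℝ) : C.certifiedLate R τ₁ ⊆ C.certifiedLate R' τ₁ := by
  rintro q (hq | hq)
  · exact Or.inl hq
  · obtain ⟨i, hi⟩ := mem_iUnion.1 hq
    refine Or.inr (mem_iUnion.2 ⟨i, image_mono (fun x hx ↦ ?_) hi⟩)
    exact ⟨hx.1, hx.2.trans (h i _)⟩

/-- Certified slabs grow with the radii. [folklore] -/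
theorem certifiedSlab_mono (C : LateChartData 𝓢 N mass spin) {R R' : Fin N → ℝ → ℝ}
    (h : ∀ i τ, R i τ ≤ R' i τ) (τ₁ : ℝ) : C.certifiedSlab R τ₁ ⊆ C.certifiedSlab R' τ₁ := by
  rintro q (hq | hq)
  · exact Or.inl hq
  · obtain ⟨i, hi⟩ := mem_iUnion.1 hq
    exact Or.inr (mem_iUnion.2 ⟨i, image_mono ((C.background i).truncTimeSlab_mono (h i τ₁) τ₁) hi⟩)

/-- **The honest radii**: `max(Rᵢ(τ), max(r₊(Mᵢ, aᵢ), 0) + 1)` — the floor demanded by `HasExhaustiveCharts` is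
bookkeeping (convergence out to `Rᵢ → ∞` is eventually convergence out to the honest radii, and exhaustion is
monotone in the radii). [cite: DafermosLuk2017, Conjecture 1 (b)] -/
def honestRadius (C : LateChartData 𝓢 N mass spin) (i : Fin N) (τ : ℝ) : ℝ :=
  max (C.radius i τ) (max (Kerr.rPlus (mass i) (spin i)) 0 + 1)

end LateChartData

section Development

variable {X : Type} [TopologicalSpace X] [ChartedSpace E3 X] [IsManifold (𝓡 3) ∞ X] [ConnectedSpace X]
  {D : InitialDataSet (𝓡 3) X}

/-- **(M2) `HoleChartsConverge 𝒟 C` — the hole charts.** Each `chart i` is a late chart into the HONEST region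
`exteriorOf 𝒟 C.charted` after `τ₀`; the near-zone radii grow, `Rᵢ(τ) → ∞` (no floor: `honestRadius`); the `C²`
deviation from boosted Kerr `(Mᵢ, aᵢ, Λᵢ, cᵢ)` on `{t*ᵢ = τ, rᵢ ≤ Rᵢ(τ)}` tends to `0`; (M2ο) `Λᵢ` is orthochronous and
the push-forward of `Λᵢ V_{Mᵢ,aᵢ}` is eventually future-directed on every truncated slab (intended producer: gluing of
the exactly-Kerr near-zone views along a representative generator path). [cite: DafermosLuk2017, Conjecture 1 (b)–(c)] -/
def HoleChartsConverge (𝒟 : CauchyDevelopment D) {N : ℕ} {mass spin : Fin N → ℝ}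
    (C : LateChartData 𝒟.toSpacetime N mass spin) : Prop :=
  (∀ i, 𝒟.toSpacetime.IsLateChart (C.background i)
    (_root_.Summit.FinalStateConjecture.exteriorOf 𝒟 C.charted) C.τ₀ (C.chart i)) ∧
  (∀ i, Tendsto (C.radius i) atTop atTop) ∧
  (∀ i, Tendsto (fun τ ↦ 𝒟.toSpacetime.truncDeviationCk (C.background i) (C.chart i) 2 (C.radius i τ) τ)
    atTop (𝓝 0)) ∧
  (∀ i, _root_.Summit.FinalStateConjecture.IsOrthochronous (C.motion i).1) ∧
  ∀ i (ρ : ℝ), ∀ᶠ τ in atTop, ∀ x ∈ (C.background i).truncTimeSlab ρ τ,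
    𝒟.timeOrientation.IsFutureDirected
      (mfderiv 𝓘(ℝ, E4) (𝓡 4) (C.chart i) x
        (((C.motion i).1 : E4 ≃L[ℝ] E4)
          (Kerr.timeVector (mass i) (spin i) (poincareInv (C.motion i).1 (C.motion i).2 (x : E4)))))

/-- **(M3) `FlatChartDecays 𝒟 C` — the radiation chart.** Sublinear tubes `ρᵢ(t)/t → 0`; the flat domain contains
`{x⁰ > τ₀} ∖ tubes`; the flat chart is a late chart into the honest region `exteriorOf 𝒟 C.charted`; the full `C²`
deviation from `η` on the flat slabs tends to `0`; and — ONLY when there is a hole, `0 < N` — flat time is eventually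
future-oriented on the slabs (at `N = 0` this is automatic, `DarkFuture.flatChart_eventually_isFutureDirected`).
Intended producer: the Minkowski classification (c) of the receding outer hull elements + uniform far constants.
[cite: ChristodoulouKlainerman1993, Thm. 1.0.2] -/
def FlatChartDecays (𝒟 : CauchyDevelopment D) {N : ℕ} {mass spin : Fin N → ℝ}
    (C : LateChartData 𝒟.toSpacetime N mass spin) : Prop :=
  (∀ i, Tendsto (fun t ↦ C.excision i t / t) atTop (𝓝 0)) ∧
  {x : E4 | C.τ₀ < x 0 ∧ ∀ i, C.excision i (x 0) <
      Kerr.radius (spin i) (poincareInv (C.motion i).1 (C.motion i).2 x)} ⊆ (C.flatDomain : Set E4) ∧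
  𝒟.toSpacetime.IsLateChart (Minkowski.backgroundOn C.flatDomain)
    (_root_.Summit.FinalStateConjecture.exteriorOf 𝒟 C.charted) C.τ₀ C.flatChart ∧
  Tendsto (fun τ ↦ 𝒟.toSpacetime.deviationCk (Minkowski.backgroundOn C.flatDomain) C.flatChart 2 τ)
    atTop (𝓝 0) ∧
  (0 < N → ∀ᶠ τ in atTop, ∀ x ∈ (Minkowski.backgroundOn C.flatDomain).timeSlab τ,
    𝒟.timeOrientation.IsFutureDirected (mfderiv 𝓘(ℝ, E4) (𝓡 4) C.flatChart x (E4.basisVector 0)))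

/-- **(M4) `ChartsExhaust 𝒟 C` — causal bookkeeping.** The truncated world-tubes of distinct holes are eventually
disjoint, and for EVERY `τ₁ ≥ τ₀` each point of the honest exterior outside the certified late region after `τ₁` lies
in the causal past of the certified slab at `τ₁` (`τ₁ = τ₀` is the structure's covering clause, `τ₁ > τ₀` is clause
(iii) of `HasExhaustiveCharts`; intended producer: horizon-normalised charts, `…RFutureEscapingPaths`).
[cite: DafermosLuk2017, Conjecture 1 (b)] -/
def ChartsExhaust (𝒟 : CauchyDevelopment D) {N : ℕ} {mass spin : Fin N → ℝ}
    (C : LateChartData 𝒟.toSpacetime N mass spin) : Prop :=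
  (∀ R : ℝ, ∃ τ₁ : ℝ, Pairwise (Function.onFun Disjoint fun i ↦
    C.chart i '' (C.background i).truncLateRegion τ₁ R)) ∧
  ∀ τ₁ : ℝ, C.τ₀ ≤ τ₁ →
    _root_.Summit.FinalStateConjecture.exteriorOf 𝒟 C.charted \ C.certifiedLate C.radius τ₁ ⊆
      𝒟.metric.causalPast 𝒟.timeOrientation (C.certifiedSlab C.radius τ₁)

/-! ### §2 Assembly: (M2) ∧ (M3) ∧ (M4) ⇒ an honest, exhaustive, future-oriented decomposition -/

/-- **Exhaustion at `τ₀` is the covering clause of `FinalStateDecomposition`** (the certified sets lie in the full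
late images / slabs and `J⁻` is monotone). [cite: ONeillSemiRiemannian1983, Ch. 14 (p. 403)] -/
theorem diff_charted_subset_causalPast (𝒟 : CauchyDevelopment D) {N : ℕ} {mass spin : Fin N → ℝ}
    (C : LateChartData 𝒟.toSpacetime N mass spin) (h₄ : ChartsExhaust 𝒟 C) :
    _root_.Summit.FinalStateConjecture.exteriorOf 𝒟 C.charted \
        ((⋃ i, C.chart i '' (C.background i).lateRegion C.τ₀) ∪
          C.flatChart '' (Minkowski.backgroundOn C.flatDomain).lateRegion C.τ₀) ⊆
      𝒟.metric.causalPast 𝒟.timeOrientation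
        ((⋃ i, C.chart i '' (C.background i).timeSlab C.τ₀) ∪
          C.flatChart '' (Minkowski.backgroundOn C.flatDomain).timeSlab C.τ₀) :=
  fun q hq ↦ by
    refine LorentzianMetric.causalFuture_mono ?_ (h₄.2 C.τ₀ le_rfl ⟨hq.1, fun h ↦ hq.2 ?_⟩)
    · rintro p (hp | hp)
      · exact Or.inr hp
      · obtain ⟨i, hi⟩ := mem_iUnion.1 hp
        exact Or.inl (mem_iUnion.2 ⟨i, image_mono ((C.background i).truncTimeSlab_subset_timeSlab _ _) hi⟩)
    · rcases h with h | h
      · exact Or.inr h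
      · obtain ⟨i, hi⟩ := mem_iUnion.1 h
        exact Or.inl (mem_iUnion.2 ⟨i, image_mono (fun x hx ↦ hx.1) hi⟩)

/-- **The decomposition assembled from late chart data** satisfying (M2)–(M4) with sub-extremal parameters, of the
honest region `exteriorOf 𝒟 C.charted`, in `C²`: fixed-radius convergence from growing radii, covering from exhaustion
at `τ₀`. [cite: DafermosLuk2017, Conjecture 1] -/
def toDecomposition (𝒟 : CauchyDevelopment D) {N : ℕ} {mass spin : Fin N → ℝ}
    (C : LateChartData 𝒟.toSpacetime N mass spin) (hM : ∀ i, 0 < mass i ∧ |spin i| < mass i)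
    (h₂ : HoleChartsConverge 𝒟 C) (h₃ : FlatChartDecays 𝒟 C) (h₄ : ChartsExhaust 𝒟 C) :
    FinalStateDecomposition 𝒟.toSpacetime (_root_.Summit.FinalStateConjecture.exteriorOf 𝒟 C.charted) 2 where
  N := N
  mass := mass
  spin := spin
  mass_pos i := (hM i).1
  abs_spin_le_mass i := (hM i).2.le
  motion := C.motion
  τ₀ := C.τ₀
  chart := C.chart
  isLateChart := h₂.1
  tendsto_truncDeviationCk i R := -- growing-radius convergence serves every fixed radius (eventually `R ≤ Rᵢ(τ)`)
    tendsto_of_tendsto_of_tendsto_of_le_of_le' tendsto_const_nhds (h₂.2.2.1 i) (Eventually.of_forall fun _ ↦ zero_le)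
      (((h₂.2.1 i).eventually_ge_atTop R).mono fun τ hτ ↦ 𝒟.toSpacetime.truncDeviationCk_mono _ _ 2 hτ τ)
  exists_pairwise_disjoint := h₄.1
  excision := C.excision
  tendsto_excision_div := h₃.1
  flatDomain := C.flatDomain
  setOf_lt_excision_subset_flatDomain := h₃.2.1
  flatChart := C.flatChart
  isLateChart_flat := h₃.2.2.1
  tendsto_deviationCk_flat := h₃.2.2.2.1
  diff_subset_causalPast := diff_charted_subset_causalPast 𝒟 C h₄

/-- **Assembly theorem: (M2) ∧ (M3) ∧ (M4) with sub-extremal parameters ⇒ the conclusion of T′** (with `d.N = N`):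
honesty `O = exteriorOf 𝒟 d.charted` is definitional, `HasExhaustiveCharts` takes the radii of (M2) and the exhaustion
of (M4) for `τ₁ > τ₀`, `IsFutureOriented` takes (i), (ii) from (M2) and (iii) from (M3) when `0 < N`, from
`DarkFuture.flatChart_eventually_isFutureDirected` when `N = 0`. [cite: DafermosLuk2017, Conjecture 1] -/
theorem exists_decomposition_of_charts (𝒟 : CauchyDevelopment D) {N : ℕ} {mass spin : Fin N → ℝ}
    (C : LateChartData 𝒟.toSpacetime N mass spin) (hM : ∀ i, 0 < mass i ∧ |spin i| < mass i)
    (h₂ : HoleChartsConverge 𝒟 C) (h₃ : FlatChartDecays 𝒟 C) (h₄ : ChartsExhaust 𝒟 C) :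
    ∃ (O : Set 𝒟.carrier) (d : FinalStateDecomposition 𝒟.toSpacetime O 2), d.N = N ∧
      O = _root_.Summit.FinalStateConjecture.exteriorOf 𝒟 d.charted ∧
        _root_.Summit.FinalStateConjecture.HasExhaustiveCharts d ∧
          _root_.Summit.FinalStateConjecture.IsFutureOriented d := by
  refine ⟨_, toDecomposition 𝒟 C hM h₂ h₃ h₄, rfl, rfl, ⟨C.honestRadius, fun i ↦ ⟨?_, fun τ ↦ le_max_right _ _⟩,
    fun i ↦ ?_, fun τ₁ hτ₁ q hq ↦ ?_⟩, h₂.2.2.2.1, h₂.2.2.2.2, ?_⟩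
  · exact tendsto_atTop_mono (fun τ ↦ le_max_left _ _) (h₂.2.1 i)
  · refine (h₂.2.2.1 i).congr'
      (((h₂.2.1 i).eventually_ge_atTop (max (Kerr.rPlus (mass i) (spin i)) 0 + 1)).mono fun τ hτ ↦ ?_)
    simp only [LateChartData.honestRadius, max_eq_left hτ]
    rfl
  · exact LorentzianMetric.causalFuture_mono (C.certifiedSlab_mono (fun i τ ↦ le_max_left _ _) τ₁)
      (h₄.2 τ₁ hτ₁.le ⟨hq.1, fun h ↦ hq.2 (C.certifiedLate_mono (fun i τ ↦ le_max_left _ _) τ₁ h)⟩)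
  rcases Nat.eq_zero_or_pos N with hN | hN
  · exact flatChart_eventually_isFutureDirected 𝒟 (toDecomposition 𝒟 C hM h₂ h₃ h₄) hN fun q hq ↦ hq.1
  · exact h₃.2.2.2.2 hN

/-- **The dispersive fibre closes given exactly the radiation chart and its bookkeeping** (what (M3) ∧ (M4) must
supply at `N = 0`, nothing about hulls): a flat chart `Ψ` on `U ⊇ {x⁰ > τ₀}` which is a late chart into the honest
region `O = J⁺(ι X) ∩ I⁻(Ψ({x⁰ > τ₀}))`, with full `C²` decay on the slabs `{x⁰ = τ}` and, for every `τ₁ ≥ τ₀`,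
`O ∖ Ψ({x⁰ > τ₁}) ⊆ J⁻(Ψ({x⁰ = τ₁}))`, yields `O`, a hole-free `d` with `O = exteriorOf 𝒟 d.charted`,
`HasExhaustiveCharts d` and `IsFutureOriented d` (orientation by p150272). [cite: ChristodoulouKlainerman1993, Thm. 1.0.2] -/
theorem exists_decomposition_dispersive (𝒟 : CauchyDevelopment D) (τ₀ : ℝ) (U : Opens E4)
    (Ψ : U → 𝒟.carrier) (hU : Minkowski.lateRegion τ₀ ⊆ (U : Set E4))
    (hΨ : 𝒟.toSpacetime.IsLateChart (Minkowski.backgroundOn U) (_root_.Summit.FinalStateConjecture.exteriorOf 𝒟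
      (Ψ '' (Minkowski.backgroundOn U).lateRegion τ₀)) τ₀ Ψ)
    (hdec : Tendsto (fun τ ↦ 𝒟.toSpacetime.deviationCk (Minkowski.backgroundOn U) Ψ 2 τ) atTop (𝓝 0))
    (hex : ∀ τ₁ : ℝ, τ₀ ≤ τ₁ → _root_.Summit.FinalStateConjecture.exteriorOf 𝒟
        (Ψ '' (Minkowski.backgroundOn U).lateRegion τ₀) \ Ψ '' (Minkowski.backgroundOn U).lateRegion τ₁ ⊆
      𝒟.metric.causalPast 𝒟.timeOrientation (Ψ '' (Minkowski.backgroundOn U).timeSlab τ₁)) :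
    ∃ (O : Set 𝒟.carrier) (d : FinalStateDecomposition 𝒟.toSpacetime O 2), d.N = 0 ∧
      O = _root_.Summit.FinalStateConjecture.exteriorOf 𝒟 d.charted ∧
        _root_.Summit.FinalStateConjecture.HasExhaustiveCharts d ∧
          _root_.Summit.FinalStateConjecture.IsFutureOriented d := by
  let C : LateChartData 𝒟.toSpacetime 0 Fin.elim0 Fin.elim0 :=
    ⟨Fin.elim0, τ₀, fun i ↦ i.elim0, Fin.elim0, Fin.elim0, U, Ψ⟩
  have hch : C.charted = Ψ '' (Minkowski.backgroundOn U).lateRegion τ₀ := by simp [LateChartData.charted, C]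
  refine exists_decomposition_of_charts 𝒟 C (fun i ↦ i.elim0)
    ⟨fun i ↦ i.elim0, fun i ↦ i.elim0, fun i ↦ i.elim0, fun i ↦ i.elim0, fun i ↦ i.elim0⟩
    ⟨fun i ↦ i.elim0, fun x hx ↦ hU hx.1, by rw [hch]; exact hΨ, hdec, fun h ↦ absurd h (lt_irrefl 0)⟩
    ⟨fun R ↦ ⟨0, fun i ↦ i.elim0⟩, fun τ₁ hτ₁ ↦ ?_⟩
  simpa [hch, LateChartData.certifiedLate, LateChartData.certifiedSlab, C] using hex τ₁ hτ₁

end Development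

/-! ### §3 (M1) Finitely many late horizon components, with representative generator paths -/

section Hull

variable {X : Type} [TopologicalSpace X] [ChartedSpace E3 X] [IsManifold (𝓡 3) ∞ X] [ConnectedSpace X]
  {D : InitialDataSet (𝓡 3) X}

/-- **Late-joined generator paths** (w.r.t. the set `K`): some point `γ s` of the late horizon
`horizonOf 𝒟 ∖ J⁻(K)` has `γ' s'` in its connected component there — for horizon generator paths (whose tails stay in
the late horizon by causal monotonicity) this says: the tails of `γ` and `γ'` run in the SAME late horizon component.
[cite: HawkingEllis1973CUP, §9.2 (p. 319)] -/
def LateJoined (𝒟 : VacuumCauchyDevelopment D) [𝒟.metric.HasLeviCivita] (K : Set 𝒟.carrier)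
    (γ γ' : ℝ → 𝒟.carrier) : Prop :=
  ∃ s s' : ℝ, γ s ∈ horizonOf 𝒟 \ 𝒟.metric.causalPast 𝒟.timeOrientation K ∧
    γ' s' ∈ connectedComponentIn (horizonOf 𝒟 \ 𝒟.metric.causalPast 𝒟.timeOrientation K) (γ s)

/-- **Representative generator paths of the late horizon components** (the output shape of (M1)). `γ₁, …, γ_N` are
horizon generator paths (`TameHull.IsHorizonPath`) and there is a sequence of compact sets `Kₙ` whose causal pasts
swallow every compact part of the horizon at some stage, such that for EVERY `n`: in the late horizon
`horizonOf 𝒟 ∖ J⁻(Kₙ)` the representatives run in pairwise distinct components (no over-count) and every horizon generator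
path is late-joined to some representative (no under-count: asked along the whole sequence, so that early junctions and
mergers — a compact part of the horizon, inside `J⁻(Kₙ)` for some `n` — do not fuse final holes). Topology of the hull
and the class play no role. [cite: HawkingEllis1973CUP, §9.2 (p. 319)] -/
def RepresentsLateComponents (𝒟 : VacuumCauchyDevelopment D) [𝒟.metric.HasLeviCivita] {N : ℕ}
    (γ_ : Fin N → ℝ → 𝒟.carrier) : Prop :=
  (∀ i, IsHorizonPath 𝒟 (γ_ i)) ∧
  ∃ K_ : ℕ → Set 𝒟.carrier, (∀ n, IsCompact (K_ n)) ∧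
    (∀ K : Set 𝒟.carrier, IsCompact K → K ⊆ horizonOf 𝒟 → ∃ n, K ⊆ 𝒟.metric.causalPast 𝒟.timeOrientation (K_ n)) ∧
    ∀ n, Pairwise (fun i j ↦ ¬ LateJoined 𝒟 (K_ n) (γ_ i) (γ_ j)) ∧
      ∀ γ : ℝ → 𝒟.carrier, IsHorizonPath 𝒟 γ → ∃ i, LateJoined 𝒟 (K_ n) (γ_ i) γ

/-- **(M1) `FiniteLateHorizonComponents 𝒟` — the late event horizon of the development has finitely many
components**, with representative generator paths (intended producer: an exactly-Kerr class member has mass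
`≥ c(Λ)·r₀` by Kretschmann pinning, `…RHullKretschmann` / `…RKerrDocCurvature`, against a total mass / horizon-area
budget over `CauchyDevelopment`). [cite: ChruscielEtAl2001, Thm 1.1] -/
def FiniteLateHorizonComponents (𝒟 : VacuumCauchyDevelopment D) [𝒟.metric.HasLeviCivita] : Prop :=
  ∃ (N : ℕ) (γ_ : Fin N → ℝ → 𝒟.carrier), RepresentsLateComponents 𝒟 γ_

/-- **On the fibre `horizonOf 𝒟 = ∅`, (M1) holds with `N = 0`** (no compact part of the horizon but `∅`, no horizon
generator path; `Kₙ = ∅`). [folklore] -/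
theorem representsLateComponents_of_horizonOf_eq_empty (𝒟 : VacuumCauchyDevelopment D) [𝒟.metric.HasLeviCivita]
    (h : horizonOf 𝒟 = ∅) : RepresentsLateComponents 𝒟 (fun i : Fin 0 ↦ i.elim0) :=
  ⟨fun i ↦ i.elim0, fun _ ↦ ∅, fun _ ↦ isCompact_empty, fun K _ hK ↦ ⟨0, fun x hx ↦ absurd (hK hx) (by simp [h])⟩,
    fun _ ↦ ⟨fun i ↦ i.elim0, fun γ hγ ↦ absurd (hγ.2.1 0) (by simp [h])⟩⟩

/-- (M1) holds on the fibre `horizonOf 𝒟 = ∅`. [folklore] -/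
theorem finiteLateHorizonComponents_of_horizonOf_eq_empty (𝒟 : VacuumCauchyDevelopment D) [𝒟.metric.HasLeviCivita]
    (h : horizonOf 𝒟 = ∅) : FiniteLateHorizonComponents 𝒟 := ⟨0, _, representsLateComponents_of_horizonOf_eq_empty 𝒟 h⟩
/-- **Representatives count the dispersive fibre exactly: `N = 0 ↔ horizonOf 𝒟 = ∅`** (⇒ through every horizon
point passes a generator path, `exists_horizonPath_iff` of `…RHorizonPathsExist`, late-joined to some `γᵢ`, `i : Fin N`;
⇐ each `γᵢ 0` is a horizon point). So in the reduction below the hole count of the assembled decomposition vanishes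
exactly on the dispersive fibre, where (M2) is vacuous and (M3) ∧ (M4) are `exists_decomposition_dispersive`'s inputs.
[cite: HawkingEllis1973CUP, §9.2 (p. 319)] -/
theorem RepresentsLateComponents.eq_zero_iff {𝒟 : VacuumCauchyDevelopment D} [𝒟.metric.HasLeviCivita] {N : ℕ}
    {γ_ : Fin N → ℝ → 𝒟.carrier} (hγ : RepresentsLateComponents 𝒟 γ_) : N = 0 ↔ horizonOf 𝒟 = ∅ := by
  refine ⟨fun hN ↦ not_nonempty_iff_eq_empty.1 fun hne ↦ ?_, fun h ↦ ?_⟩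
  · obtain ⟨γ, hγ'⟩ := (ChannelsResolveTameDevelopmentsR.HorizonGenerators.exists_horizonPath_iff 𝒟).2 hne
    obtain ⟨-, K_, -, -, hK⟩ := hγ
    obtain ⟨i, -⟩ := (hK 0).2 γ hγ'
    exact absurd (hN ▸ i.pos) (lt_irrefl 0)
  · rcases Nat.eq_zero_or_pos N with hN | hN
    · exact hN
    · exact absurd ((hγ.1 ⟨0, hN⟩).2.1 0) (by simp [h])

end Hull

/-! ### §4 The reduction of T′: its registered text from (M1) and the chart producer (M2)–(M4) -/

/-- **Reduction of stub T′ `stub_tameEndgame` to (M1)–(M4)** (T′'s registered text VERBATIM as the conclusion).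
Hypothesis: for every development as in Φ with nonempty outer region and every class `(Λ, r₀)`, `0 < r₀`, with
(a)–(d): (M1) the late horizon has finitely many components with representatives, AND for every system of
representatives `γᵢ`, `i < N`, and every choice of sub-extremal `(Mᵢ, aᵢ)` classifying ALL horizon-hull elements along
`γᵢ` as exact Kerr `(Mᵢ, aᵢ)` d.o.c.s, there are late chart data with `N` holes of THESE parameters satisfying (M2)
hole convergence, (M3) flat decay, (M4) exhaustion — a structured strengthening of T′ (holes indexed by the late horizon
components, carrying the pinned parameters). Logic: (d) instantiated at the representatives supplies the parameters
(`choose`); §2 assembles (fixed radii, honest radii, covering, orientation at `N = 0` by p150272). (a)–(d), `DevHyp`,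
admissibility and the nonempty outer region are also handed to the producers. [cite: DafermosLuk2017, Conjecture 1] -/
theorem tameEndgame_of_assembly : (∀ {X : Type} [TopologicalSpace X] [ChartedSpace E3 X] [IsManifold (𝓡 3) ∞ X] [T2Space X] [SecondCountableTopology X] [ConnectedSpace X] {D : InitialDataSet (𝓡 3) X}, D ∈ admissibleVacuumData X → ∀ (𝒟 : VacuumCauchyDevelopment D) [𝒟.metric.HasLeviCivita], DevHyp 𝒟 → (outerRegion 𝒟).Nonempty → ∀ (Λ : ℕ → ℝ≥0) (r₀ : ℝ), 0 < r₀ → OuterHullExists 𝒟 Λ r₀ → GeneratorHullExists 𝒟 Λ r₀ → (∀ (q : ℕ → 𝒟.carrier) (𝓢 : Spacetime.{0} 4) (E : EndDatum 𝓢) (p : 𝓢.carrier), IsSilentHullElement 𝒟 Λ r₀ q 𝓢 E p → IsMinkowski 𝓢 ∨ ∃ M a : ℝ, 0 < M ∧ |a| < M ∧ IsKerrDoc 𝓢 E.doc M a) → (∀ γ : ℝ → 𝒟.carrier, IsHorizonPath 𝒟 γ → ∃ M a : ℝ, 0 < M ∧ |a| < M ∧ ∀ (𝓢 : Spacetime.{0}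 4) (E : EndDatum 𝓢) (p : 𝓢.carrier), IsHorizonHullElement 𝒟 Λ r₀ γ 𝓢 E p → IsKerrDoc 𝓢 E.doc M a) → FiniteLateHorizonComponents 𝒟 ∧ ∀ (N : ℕ) (γ_ : Fin N → ℝ → 𝒟.carrier), RepresentsLateComponents 𝒟 γ_ → ∀ (M a : Fin N → ℝ), (∀ i, 0 < M i ∧ |a i| < M i ∧ ∀ (𝓢 : Spacetime.{0} 4) (E : EndDatum 𝓢) (p : 𝓢.carrier), IsHorizonHullElement 𝒟 Λ r₀ (γ_ i) 𝓢 E p → IsKerrDoc 𝓢 E.doc (M i) (a i)) → ∃ C : LateChartData 𝒟.toSpacetime N M a, HoleChartsConverge 𝒟.toCauchyDevelopment C ∧ FlatChartDecays 𝒟.toCauchyDevelopment C ∧ ChartsExhaust 𝒟.toCauchyDevelopment C) → ∀ (X : Type) [TopologicalSpace X] [ChartedSpace E3 X] [IsManifold (𝓡 3) ∞ X] [T2Space X] [SecondCountableTopology X] [ConnectedSpace X], ∀ D ∈ admissibleVacuumData X, ∀ (𝒟 : VacuumCauchyDevelopment D) [𝒟.metric.HasLeviCivita], DevHyp 𝒟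 → (outerRegion 𝒟).Nonempty → (∃ (Λ : ℕ → ℝ≥0) (r₀ : ℝ), 0 < r₀ ∧ OuterHullExists 𝒟 Λ r₀ ∧ GeneratorHullExists 𝒟 Λ r₀ ∧ (∀ (q : ℕ → 𝒟.carrier) (𝓢 : Spacetime.{0} 4) (E : EndDatum 𝓢) (p : 𝓢.carrier), IsSilentHullElement 𝒟 Λ r₀ q 𝓢 E p → IsMinkowski 𝓢 ∨ ∃ M a : ℝ, 0 < M ∧ |a| < M ∧ IsKerrDoc 𝓢 E.doc M a) ∧ (∀ γ : ℝ → 𝒟.carrier, IsHorizonPath 𝒟 γ → ∃ M a : ℝ, 0 < M ∧ |a| < M ∧ ∀ (𝓢 : Spacetime.{0} 4) (E : EndDatum 𝓢) (p : 𝓢.carrier), IsHorizonHullElement 𝒟 Λ r₀ γ 𝓢 E p → IsKerrDoc 𝓢 E.doc M a)) → ∃ (O : Set 𝒟.carrier) (d : FinalStateDecomposition 𝒟.toSpacetime O 2), O = _root_.Summit.FinalStateConjecture.exteriorOf 𝒟.toCauchyDevelopment d.charted ∧ _root_.Summit.FinalStateConjecture.HasExhaustiveCharts d ∧ _root_.Summit.FinalStateConjecture.IsFutureOriented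 d := by
  rintro H X _ _ _ _ _ _ D hD 𝒟 _ hdev hne ⟨Λ, r₀, hr₀, ha, hb, hc, hd⟩
  obtain ⟨⟨N, γ_, hrep⟩, hprod⟩ := H hD 𝒟 hdev hne Λ r₀ hr₀ ha hb hc hd
  choose M a hMa using fun i ↦ hd (γ_ i) (hrep.1 i)
  obtain ⟨C, h₂, h₃, h₄⟩ := hprod N γ_ hrep M a hMa
  obtain ⟨O, d, -, hO, hex, hfo⟩ := exists_decomposition_of_charts 𝒟.toCauchyDevelopment C
    (fun i ↦ ⟨(hMa i).1, (hMa i).2.1⟩) h₂ h₃ h₄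
  exact ⟨O, d, hO, hex, hfo⟩


/-- **Registered form of `exists_decomposition_dispersive`** (sub-goal of T′: in EVERY Cauchy development the
`N = 0` fibre of the endgame closes given exactly the radiation chart (M3) and its bookkeeping (M4) — a flat late
chart on `U ⊇ {x⁰ > τ₀}` into its honest region, full `C²` decay, exhaustion for all `τ₁ ≥ τ₀`).
[cite: ChristodoulouKlainerman1993, Thm. 1.0.2] -/
theorem tameEndgame_dispersive_of_flatChart : ∀ {X : Type} [TopologicalSpace X] [ChartedSpace E3 X] [IsManifold (𝓡 3) ∞ X] [ConnectedSpace X] {D : InitialDataSet (𝓡 3) X} (𝒟 : CauchyDevelopment D) (τ₀ : ℝ) (U : Opens E4) (Ψ : U → 𝒟.carrier), Minkowski.lateRegion τ₀ ⊆ (U : Set E4) → 𝒟.toSpacetime.IsLateChart (Minkowski.backgroundOn U) (_root_.Summit.FinalStateConjecture.exteriorOf 𝒟 (Ψ '' (Minkowski.backgroundOn U).lateRegion τ₀)) τ₀ Ψ → Tendsto (fun τ ↦ 𝒟.toSpacetime.deviationCk (Minkowski.backgroundOn U) Ψ 2 τ) atTop (𝓝 0) → (∀ τ₁ : ℝ,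 τ₀ ≤ τ₁ → _root_.Summit.FinalStateConjecture.exteriorOf 𝒟 (Ψ '' (Minkowski.backgroundOn U).lateRegion τ₀) \ Ψ '' (Minkowski.backgroundOn U).lateRegion τ₁ ⊆ 𝒟.metric.causalPast 𝒟.timeOrientation (Ψ '' (Minkowski.backgroundOn U).timeSlab τ₁)) → ∃ (O : Set 𝒟.carrier) (d : FinalStateDecomposition 𝒟.toSpacetime O 2), d.N = 0 ∧ O = _root_.Summit.FinalStateConjecture.exteriorOf 𝒟 d.charted ∧ _root_.Summit.FinalStateConjecture.HasExhaustiveCharts d ∧ _root_.Summit.FinalStateConjecture.IsFutureOriented d :=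
  fun 𝒟 τ₀ U Ψ hU hΨ hdec hex ↦ exists_decomposition_dispersive 𝒟 τ₀ U Ψ hU hΨ hdec hex

end Summit.FinalStateConjecture.FinalStateConjecture.Theorems.TameLaSalle
end
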